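/-
Copyright (c) 2026 the pub-hodgecm-mathlib formalisation cell (harness21).  Prover seat hodgecm-mathlib-K2E2-p12 (g5): Track B «K2-LIT», ENGINE E1,
h413 = stmt-HodgeConjecture-24833; (q10) «R7₃-SCALAR» FILE 3, brick (3-i) «LOCAL MEAN INERT» (census 2026-09-04T08:25Z → dealer K2E1-plan (g5)).
-/
import Summits.HodgeConjecture.HodgeConjecture.Theorems.K2E1IntertwiningLocalFactorU3    -- ★ FILE 2 ED. 2 §5: `integral_integral_integral_inertCell_coords_eq` (iterated closed form); brings ★ p858040 `integrable_max_one_normAbs_rpow_neg`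
import Literature.NumberTheory.Automorphic.TateLocalZetaShells                          -- ★ `secondCountableTopology_localField`, `sigmaCompactSpace_of_isNonarchimedeanLocalField`
import Mathlib.MeasureTheory.Integral.Pi
import HarnessLib

/-!
# K2·E1 — `K2E1IntertwiningLocalMeanInertU3` ((q10) «R7₃-SCALAR» FILE 3, brick (3-i)): THE INERT LOCAL MEAN AS A PRODUCT-MEASURE INTEGRAL —
# `∫_{K_v³} max(1, max(|a|,|b|)², |t|)^{−2σ} d(μ⊗μ⊗μ) = μ(𝒪)³ · (1−q^{−2σ})(1+q^{−(2σ−1)})∕[(1−q^{−(2σ−2)})(1+q^{−(2σ−2)})]`, with INTEGRABILITY for `σ > 1`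

Track B ∕ K2-LIT, crux h413 = `stmt-HodgeConjecture-24833`, route of record `HCCMUnconditional`; cell `hodgecm-mathlib`, squad K2, ENGINE E1 (campaign «EIS-RANK-ONE», R7 at
`N = 3`).  THEOREMS ONLY (no `def`, no instance, no notation, no named-fact hypothesis, no `sorry`; default heartbeats); lane `--supports stmt-HodgeConjecture-24833 --as helper`
(count-neutral).  Generic non-archimedean local field `F`, ANY additive Haar `μ`, currency `Measure.pi (fun _ : Fin 3 => μ)` on `Fin 3 → F` — the local factors of ★
`AdelicProductIntegral` at `ι = Fin 3` are GENUINE product-measure integrals, whereas ★ FILE 2 ED. 2 §5 computed the ITERATED integral; this brick is the bridge.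

THE MATHEMATICS [Langlands1971, §3; TateThesis1967, §3.3].  `W(a,b,t) := max(1, max(|a|,|b|)², |t|)` (the inert big-cell height in base coordinates, ★ `K2E1IntertwiningLocalFactorU3Height`).
* §1 INTEGRABILITY for `σ > 1` WITHOUT Tonelli: `W ≥ max(1,|a|)²`, `W ≥ max(1,|b|)²`, `W ≥ max(1,|t|)`, so splitting the exponent `2σ = α + α + γ` with `α = (5σ−2)∕6·2 …` —
  precisely **`W^{−2σ} ≤ max(1,|a|)^{−(5σ−2)∕3} · max(1,|b|)^{−(5σ−2)∕3} · max(1,|t|)^{−(σ+2)∕3}`** (`(5σ−2)∕3 + (5σ−2)∕3`·½… : `2·(5σ−2)∕6 + (σ+2)∕3 = 2σ`), and all three exponents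
  exceed `1` exactly when `σ > 1`; each factor is `μ`-integrable (★ Tate `integrable_max_one_normAbs_rpow_neg`), their tensor product is `μ³`-integrable (Mathlib
  `Integrable.fin_nat_prod`), hence so is `W^{−2σ}` (domination) — **`integrable_inertCell_pi`**.
* §2 FUBINI: separating the coordinate `a` (Mathlib `measurePreserving_piFinSuccAbove` at `i = 0`, then `finTwoArrow` on the remaining pair and `integral_prod` twice, the inner
  integrability again by domination) turns the product-measure integral into the iterated one of ★ FILE 2 ED. 2 §5:
  **`integral_inertCell_pi_eq_iterated`**, and hence the CLOSED FORM **`integral_inertCell_pi_eq`** and its FILE-1-token form **`integral_inertCell_pi_eq_localScalar`** (`ε = −1`).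
HONEST LABEL: HC_CM is proved only modulo the 7 printed citations (2 remaining named inputs: hLiu418 = `stmt-HodgeConjecture-24832`, h413 = `stmt-HodgeConjecture-24833`) until rung 0
closes; this file asserts no named fact and closes no socket; count-neutral.

## References
* [Langlands1971] R. P. Langlands, *Euler Products* (1971): §3.
* [TateThesis1967] J. Tate, in Cassels–Fröhlich (1967), Ch. XV §3.3 (local factors as integrals over `K_v^n`).
* [MoeglinWaldspurger1995] C. Mœglin, J.-L. Waldspurger, *Spectral Decomposition and Eisenstein Series* (1995): II.1.7.
-/

set_option autoImplicit false
set_option linter.dupNamespace false -- the mandated namespace repeats `HodgeConjecture.HodgeConjecture`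

noncomputable section

open MeasureTheory MeasureTheory.Measure Filter Topology Set
open scoped NNReal ENNReal
open Literature.NumberTheory.GaloisRepresentations.IsNonarchimedeanLocalField
open Literature.NumberTheory.Automorphic Literature.NumberTheory.Automorphic.LocalFieldHaar
open Summit.HodgeConjecture.HodgeConjecture.Cruxes.H413.K2E1IntertwiningLocalFactorU2 (integrable_max_one_normAbs_rpow_neg)
open Summit.HodgeConjecture.HodgeConjecture.Cruxes.H413.K2E1IntertwiningLocalFactorU3 (integral_integral_integral_inertCell_coords_eq localScalar_shape_neg_one_eq)
open Summit.HodgeConjecture.HodgeConjecture.Cruxes.HLiu418.K2LiuGKRankOneIntegral (one_lt_residueFieldCard_real)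

namespace Summit.HodgeConjecture.HodgeConjecture.Cruxes.H413.K2E1IntertwiningLocalMeanInertU3

variable {F : Type*} [Field F] [ValuativeRel F] [TopologicalSpace F] [IsNonarchimedeanLocalField F]

/-! ## §0 Pointwise: continuity and the domination `W^{−2σ} ≤ (product of one-variable factors)` -/

omit [ValuativeRel F] [TopologicalSpace F] [IsNonarchimedeanLocalField F] in
/-- Domination of a negative power of a `max` by the product of negative powers of smaller quantities: if `1 ≤ A, B, T ≤ W` then for `α, γ ≥ 0`,
`W^{−(α+α+γ)} ≤ A^{−α}·B^{−α}·T^{−γ}`. [folklore] -/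
theorem rpow_neg_le_mul_of_le {W A B T α γ : ℝ} (hA1 : 1 ≤ A) (hB1 : 1 ≤ B) (hT1 : 1 ≤ T) (hA : A ≤ W) (hB : B ≤ W) (hT : T ≤ W) (hα : 0 ≤ α) (hγ : 0 ≤ γ) :
    W ^ (-(α + α + γ)) ≤ A ^ (-α) * B ^ (-α) * T ^ (-γ) := by
  have hW : 0 < W := lt_of_lt_of_le (lt_of_lt_of_le zero_lt_one hA1) hA
  have h1 : W ^ (-α) ≤ A ^ (-α) := Real.rpow_le_rpow_of_nonpos (lt_of_lt_of_le zero_lt_one hA1) hA (by linarith)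
  have h2 : W ^ (-α) ≤ B ^ (-α) := Real.rpow_le_rpow_of_nonpos (lt_of_lt_of_le zero_lt_one hB1) hB (by linarith)
  have h3 : W ^ (-γ) ≤ T ^ (-γ) := Real.rpow_le_rpow_of_nonpos (lt_of_lt_of_le zero_lt_one hT1) hT (by linarith)
  have e : W ^ (-(α + α + γ)) = W ^ (-α) * W ^ (-α) * W ^ (-γ) := by
    rw [show -(α + α + γ) = -α + -α + -γ by ring, Real.rpow_add hW, Real.rpow_add hW]
  rw [e]
  have hWα : 0 ≤ W ^ (-α) := Real.rpow_nonneg hW.le _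
  have hWγ : 0 ≤ W ^ (-γ) := Real.rpow_nonneg hW.le _
  gcongr

/-- **THE DOMINATION**: `max(1, max(|a|,|b|)², |t|)^{−2σ} ≤ max(1,|a|)^{−(5σ−2)∕3} · max(1,|b|)^{−(5σ−2)∕3} · max(1,|t|)^{−(σ+2)∕3}` (`σ ≥ 1`), the three exponents being `> 1`
exactly when `σ > 1`. [cite: TateThesis1967, §3.3] -/
theorem inertCell_rpow_le_prod {σ : ℝ} (hσ : 1 ≤ σ) (a b t : F) :
    (max 1 (max ((max ((normAbs F a : ℝ≥0) : ℝ) ((normAbs F b : ℝ≥0) : ℝ)) ^ 2) ((normAbs F t : ℝ≥0) : ℝ))) ^ (-(2 * σ)) ≤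
      (max 1 ((normAbs F a : ℝ≥0) : ℝ)) ^ (-((5 * σ - 2) / 6 * 2)) * (max 1 ((normAbs F b : ℝ≥0) : ℝ)) ^ (-((5 * σ - 2) / 6 * 2)) *
        (max 1 ((normAbs F t : ℝ≥0) : ℝ)) ^ (-((σ + 2) / 3)) := by
  have ha0 : (0 : ℝ) ≤ ((normAbs F a : ℝ≥0) : ℝ) := NNReal.coe_nonneg _
  have hb0 : (0 : ℝ) ≤ ((normAbs F b : ℝ≥0) : ℝ) := NNReal.coe_nonneg _
  -- the three comparisons `max(1,|a|)², max(1,|b|)², max(1,|t|) ≤ W`, stated with `max(1,|a|) ≤ W` etc. (enough since `max(1,x) ≤ max(1,x)² ≤ W`)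
  set W : ℝ := max 1 (max ((max ((normAbs F a : ℝ≥0) : ℝ) ((normAbs F b : ℝ≥0) : ℝ)) ^ 2) ((normAbs F t : ℝ≥0) : ℝ)) with hW
  have hM2 : (max ((normAbs F a : ℝ≥0) : ℝ) ((normAbs F b : ℝ≥0) : ℝ)) ^ 2 ≤ W := (le_max_left _ _).trans (le_max_right _ _)
  have hA : (max 1 ((normAbs F a : ℝ≥0) : ℝ)) ^ (2 : ℝ) ≤ W := by
    rw [Real.rpow_two]
    rcases le_total ((normAbs F a : ℝ≥0) : ℝ) 1 with h | h
    · rw [max_eq_left h, one_pow]; exact le_max_left _ _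
    · rw [max_eq_right h]
      exact (pow_le_pow_left₀ ha0 (le_max_left _ _) 2).trans hM2
  have hB : (max 1 ((normAbs F b : ℝ≥0) : ℝ)) ^ (2 : ℝ) ≤ W := by
    rw [Real.rpow_two]
    rcases le_total ((normAbs F b : ℝ≥0) : ℝ) 1 with h | h
    · rw [max_eq_left h, one_pow]; exact le_max_left _ _
    · rw [max_eq_right h]
      exact (pow_le_pow_left₀ hb0 (le_max_right _ _) 2).trans hM2
  have hT : max 1 ((normAbs F t : ℝ≥0) : ℝ) ≤ W := max_le (le_max_left _ _) (le_max_of_le_right (le_max_right _ _))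
  have hA1 : (1 : ℝ) ≤ (max 1 ((normAbs F a : ℝ≥0) : ℝ)) ^ (2 : ℝ) := Real.one_le_rpow (le_max_left _ _) (by norm_num)
  have hB1 : (1 : ℝ) ≤ (max 1 ((normAbs F b : ℝ≥0) : ℝ)) ^ (2 : ℝ) := Real.one_le_rpow (le_max_left _ _) (by norm_num)
  have key := rpow_neg_le_mul_of_le (α := (5 * σ - 2) / 6) (γ := (σ + 2) / 3) hA1 hB1 (le_max_left _ _) hA hB hT
    (by linarith) (by linarith)
  rw [show -((5 * σ - 2) / 6 + (5 * σ - 2) / 6 + (σ + 2) / 3) = -(2 * σ) by ring] at key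
  refine key.trans_eq ?_
  rw [← Real.rpow_mul (le_trans zero_le_one (le_max_left _ _)), ← Real.rpow_mul (le_trans zero_le_one (le_max_left _ _))]
  congr 2 <;> ring

/-- The inert integrand `p ↦ max(1, max(|p₀|,|p₁|)², |p₂|)^{−2σ}` is continuous on `Fin 3 → F`. [folklore] -/
theorem continuous_inertCell_rpow (σ : ℝ) :
    Continuous fun p : Fin 3 → F => (max 1 (max ((max ((normAbs F (p 0) : ℝ≥0) : ℝ) ((normAbs F (p 1) : ℝ≥0) : ℝ)) ^ 2) ((normAbs F (p 2) : ℝ≥0) : ℝ))) ^ (-(2 * σ)) := by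
  have hn : ∀ i : Fin 3, Continuous fun p : Fin 3 → F => ((normAbs F (p i) : ℝ≥0) : ℝ) := fun i =>
    NNReal.continuous_coe.comp (continuous_normAbs.comp (continuous_apply i))
  have hW : Continuous fun p : Fin 3 → F => max 1 (max ((max ((normAbs F (p 0) : ℝ≥0) : ℝ) ((normAbs F (p 1) : ℝ≥0) : ℝ)) ^ 2) ((normAbs F (p 2) : ℝ≥0) : ℝ)) :=
    continuous_const.max ((((hn 0).max (hn 1)).pow 2).max (hn 2))
  exact hW.rpow_const fun p => Or.inl (lt_of_lt_of_le zero_lt_one (le_max_left _ _)).ne'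

/-! ## §1 Integrability on `(Fin 3 → F, μ⊗μ⊗μ)` for `σ > 1` -/

variable [MeasurableSpace F] [BorelSpace F] (μ : Measure F) [μ.IsAddHaarMeasure]

/-- **THE INERT LOCAL INTEGRAND IS `μ³`-INTEGRABLE FOR `σ > 1`** (domination §0 by the tensor product of three integrable one-variable Tate factors ★
`integrable_max_one_normAbs_rpow_neg`, Mathlib `Integrable.fin_nat_prod`). [cite: TateThesis1967, §3.3] [cite: Langlands1971, §3] -/
theorem integrable_inertCell_pi {σ : ℝ} (hσ : 1 < σ) :
    Integrable (fun p : Fin 3 → F => (max 1 (max ((max ((normAbs F (p 0) : ℝ≥0) : ℝ) ((normAbs F (p 1) : ℝ≥0) : ℝ)) ^ 2) ((normAbs F (p 2) : ℝ≥0) : ℝ))) ^ (-(2 * σ)))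
      (Measure.pi fun _ : Fin 3 => μ) := by
  haveI := secondCountableTopology_localField F
  haveI := sigmaCompactSpace_of_isNonarchimedeanLocalField F
  -- the dominating tensor product
  set g : Fin 3 → F → ℝ := ![fun x => (max 1 ((normAbs F x : ℝ≥0) : ℝ)) ^ (-((5 * σ - 2) / 6 * 2)),
    fun x => (max 1 ((normAbs F x : ℝ≥0) : ℝ)) ^ (-((5 * σ - 2) / 6 * 2)), fun x => (max 1 ((normAbs F x : ℝ≥0) : ℝ)) ^ (-((σ + 2) / 3))] with hg
  have hgi : ∀ i, Integrable (g i) μ := by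
    intro i
    fin_cases i
    · exact integrable_max_one_normAbs_rpow_neg μ (by linarith : 1 < (5 * σ - 2) / 6 * 2)
    · exact integrable_max_one_normAbs_rpow_neg μ (by linarith : 1 < (5 * σ - 2) / 6 * 2)
    · exact integrable_max_one_normAbs_rpow_neg μ (by linarith : 1 < (σ + 2) / 3)
  have hG : Integrable (fun p : Fin 3 → F => ∏ i, g i (p i)) (Measure.pi fun _ : Fin 3 => μ) := Integrable.fin_nat_prod hgi
  refine hG.mono' (continuous_inertCell_rpow σ).aestronglyMeasurable (Eventually.of_forall fun p => ?_)
  rw [Real.norm_of_nonneg (Real.rpow_nonneg (le_trans zero_le_one (le_max_left _ _)) _), Fin.prod_univ_three]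
  exact inertCell_rpow_le_prod hσ.le (p 0) (p 1) (p 2)

/-! ## §2 Fubini: the product-measure integral is the iterated integral of ★ FILE 2 ED. 2 §5 -/

/-- The two-variable slice `(b, t) ↦ max(1, max(|a|,|b|)², |t|)^{−2σ}` is `μ⊗μ`-integrable for every `a` (`σ > 1`; domination by `max(1,|b|)^{−(5σ−2)∕3}·max(1,|t|)^{−(σ+2)∕3}`
times the constant `max(1,|a|)^{−(5σ−2)∕3} ≤ 1`). [cite: TateThesis1967, §3.3] -/
theorem integrable_inertCell_slice {σ : ℝ} (hσ : 1 < σ) (a : F) :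
    Integrable (fun q : F × F => (max 1 (max ((max ((normAbs F a : ℝ≥0) : ℝ) ((normAbs F q.1 : ℝ≥0) : ℝ)) ^ 2) ((normAbs F q.2 : ℝ≥0) : ℝ))) ^ (-(2 * σ))) (μ.prod μ) := by
  haveI := secondCountableTopology_localField F
  haveI := sigmaCompactSpace_of_isNonarchimedeanLocalField F
  have hB := integrable_max_one_normAbs_rpow_neg μ (by linarith : 1 < (5 * σ - 2) / 6 * 2)
  have hT := integrable_max_one_normAbs_rpow_neg μ (by linarith : 1 < (σ + 2) / 3)
  have hG : Integrable (fun q : F × F => (max 1 ((normAbs F a : ℝ≥0) : ℝ)) ^ (-((5 * σ - 2) / 6 * 2)) *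
      ((max 1 ((normAbs F q.1 : ℝ≥0) : ℝ)) ^ (-((5 * σ - 2) / 6 * 2)) * (max 1 ((normAbs F q.2 : ℝ≥0) : ℝ)) ^ (-((σ + 2) / 3)))) (μ.prod μ) :=
    (hB.mul_prod hT).const_mul _
  have hcont : Continuous fun q : F × F => (max 1 (max ((max ((normAbs F a : ℝ≥0) : ℝ) ((normAbs F q.1 : ℝ≥0) : ℝ)) ^ 2) ((normAbs F q.2 : ℝ≥0) : ℝ))) ^ (-(2 * σ)) := by
    have h1 : Continuous fun q : F × F => ((normAbs F q.1 : ℝ≥0) : ℝ) := NNReal.continuous_coe.comp (continuous_normAbs.comp continuous_fst)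
    have h2 : Continuous fun q : F × F => ((normAbs F q.2 : ℝ≥0) : ℝ) := NNReal.continuous_coe.comp (continuous_normAbs.comp continuous_snd)
    exact (continuous_const.max (((continuous_const.max h1).pow 2).max h2)).rpow_const fun q => Or.inl (lt_of_lt_of_le zero_lt_one (le_max_left _ _)).ne'
  refine hG.mono' hcont.aestronglyMeasurable (Eventually.of_forall fun q => ?_)
  rw [Real.norm_of_nonneg (Real.rpow_nonneg (le_trans zero_le_one (le_max_left _ _)) _), ← mul_assoc]
  exact inertCell_rpow_le_prod hσ.le a q.1 q.2

/-- **FUBINI FOR THE INERT LOCAL INTEGRAND**: for `σ > 1`,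
`∫_{Fin 3 → F} max(1, max(|p₀|,|p₁|)², |p₂|)^{−2σ} d(μ⊗μ⊗μ) = ∫_a ∫_b ∫_t max(1, max(|a|,|b|)², |t|)^{−2σ} dμ dμ dμ` (separate `p₀` by `piFinSuccAbove 0`, then `finTwoArrow`, Mathlib
`integral_prod` twice; integrability §1 and the slice lemma). [cite: TateThesis1967, §3.3] -/
theorem integral_inertCell_pi_eq_iterated {σ : ℝ} (hσ : 1 < σ) :
    ∫ p : Fin 3 → F, (max 1 (max ((max ((normAbs F (p 0) : ℝ≥0) : ℝ) ((normAbs F (p 1) : ℝ≥0) : ℝ)) ^ 2) ((normAbs F (p 2) : ℝ≥0) : ℝ))) ^ (-(2 * σ)) ∂(Measure.pi fun _ : Fin 3 => μ) =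
      ∫ a, ∫ b, ∫ t, (max 1 (max ((max ((normAbs F a : ℝ≥0) : ℝ) ((normAbs F b : ℝ≥0) : ℝ)) ^ 2) ((normAbs F t : ℝ≥0) : ℝ))) ^ (-(2 * σ)) ∂μ ∂μ ∂μ := by
  haveI := secondCountableTopology_localField F
  haveI := sigmaCompactSpace_of_isNonarchimedeanLocalField F
  set f : (Fin 3 → F) → ℝ := fun p => (max 1 (max ((max ((normAbs F (p 0) : ℝ≥0) : ℝ) ((normAbs F (p 1) : ℝ≥0) : ℝ)) ^ 2) ((normAbs F (p 2) : ℝ≥0) : ℝ))) ^ (-(2 * σ)) with hf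
  have hfi : Integrable f (Measure.pi fun _ : Fin 3 => μ) := integrable_inertCell_pi μ hσ
  -- Step 1: separate the coordinate `0`
  set e : (Fin 3 → F) ≃ᵐ F × (Fin 2 → F) := MeasurableEquiv.piFinSuccAbove (fun _ : Fin 3 => F) 0 with he_def
  have he : MeasurePreserving e (Measure.pi fun _ : Fin 3 => μ) (μ.prod (Measure.pi fun _ : Fin 2 => μ)) :=
    measurePreserving_piFinSuccAbove (fun _ : Fin 3 => μ) 0
  have hsymm : ∀ q : F × (Fin 2 → F), f (e.symm q) =
      (max 1 (max ((max ((normAbs F q.1 : ℝ≥0) : ℝ) ((normAbs F (q.2 0) : ℝ≥0) : ℝ)) ^ 2) ((normAbs F (q.2 1) : ℝ≥0) : ℝ))) ^ (-(2 * σ)) := by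
    intro q
    have h0 : e.symm q 0 = q.1 := by
      rw [he_def, MeasurableEquiv.piFinSuccAbove_symm_apply, Fin.insertNthEquiv_apply]
      exact Fin.insertNth_apply_same _ _ _
    have h1 : e.symm q 1 = q.2 0 := by
      rw [he_def, MeasurableEquiv.piFinSuccAbove_symm_apply, Fin.insertNthEquiv_apply, show (1 : Fin 3) = Fin.succAbove 0 0 by decide]
      exact Fin.insertNth_apply_succAbove _ _ _ _
    have h2 : e.symm q 2 = q.2 1 := by
      rw [he_def, MeasurableEquiv.piFinSuccAbove_symm_apply, Fin.insertNthEquiv_apply, show (2 : Fin 3) = Fin.succAbove 0 1 by decide]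
      exact Fin.insertNth_apply_succAbove _ _ _ _
    simp only [hf, h0, h1, h2]
  have step1 : ∫ p, f p ∂(Measure.pi fun _ : Fin 3 => μ) = ∫ q, f (e.symm q) ∂(μ.prod (Measure.pi fun _ : Fin 2 => μ)) :=
    (he.symm.integral_comp' (g := f)).symm
  have hfi' : Integrable (fun q => f (e.symm q)) (μ.prod (Measure.pi fun _ : Fin 2 => μ)) :=
    (he.symm.integrable_comp_emb e.symm.measurableEmbedding).2 hfi
  rw [step1, integral_prod _ hfi']
  refine integral_congr_ae (Eventually.of_forall fun a => ?_)
  -- Step 2: the inner integral over `Fin 2 → F` is a double integral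
  have h2 : MeasurePreserving (MeasurableEquiv.finTwoArrow (α := F)) (Measure.pi fun _ : Fin 2 => μ) (μ.prod μ) := measurePreserving_finTwoArrow μ
  have hslice := integrable_inertCell_slice μ hσ a
  have step2 : ∫ r : Fin 2 → F, f (e.symm (a, r)) ∂(Measure.pi fun _ : Fin 2 => μ) =
      ∫ q : F × F, (max 1 (max ((max ((normAbs F a : ℝ≥0) : ℝ) ((normAbs F q.1 : ℝ≥0) : ℝ)) ^ 2) ((normAbs F q.2 : ℝ≥0) : ℝ))) ^ (-(2 * σ)) ∂(μ.prod μ) := by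
    rw [← h2.symm.integral_comp']
    refine integral_congr_ae (Eventually.of_forall fun q => ?_)
    have hq0 : (MeasurableEquiv.finTwoArrow (α := F)).symm q 0 = q.1 := rfl
    have hq1 : (MeasurableEquiv.finTwoArrow (α := F)).symm q 1 = q.2 := rfl
    simp only [hsymm]
    rw [hq0, hq1]
  beta_reduce
  rw [step2, integral_prod _ hslice]

/-- **THE INERT LOCAL MEAN AS A PRODUCT-MEASURE INTEGRAL, CLOSED FORM** (`σ > 1`, `q = residueFieldCard F`):
`∫_{Fin 3 → F} max(1, max(|p₀|,|p₁|)², |p₂|)^{−2σ} d(μ⊗μ⊗μ) = μ(𝒪)³ · (1 − q^{−2σ})(1 + q^{−(2σ−1)}) ∕ [(1 − q^{−(2σ−2)})(1 + q^{−(2σ−2)})]` (§2 + ★ FILE 2 ED. 2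
`integral_integral_integral_inertCell_coords_eq`). [cite: Langlands1971, §3] [cite: MoeglinWaldspurger1995, II.1.7] -/
theorem integral_inertCell_pi_eq {σ : ℝ} (hσ : 1 < σ) :
    ∫ p : Fin 3 → F, (max 1 (max ((max ((normAbs F (p 0) : ℝ≥0) : ℝ) ((normAbs F (p 1) : ℝ≥0) : ℝ)) ^ 2) ((normAbs F (p 2) : ℝ≥0) : ℝ))) ^ (-(2 * σ)) ∂(Measure.pi fun _ : Fin 3 => μ) =
      μ.real (primePowBall F 0) ^ 3 *
        ((1 - (residueFieldCard F : ℝ) ^ (-(2 * σ))) * (1 + (residueFieldCard F : ℝ) ^ (-(2 * σ - 1))) /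
          ((1 - (residueFieldCard F : ℝ) ^ (-(2 * σ - 2))) * (1 + (residueFieldCard F : ℝ) ^ (-(2 * σ - 2))))) := by
  rw [integral_inertCell_pi_eq_iterated μ hσ, integral_integral_integral_inertCell_coords_eq μ hσ]

/-- **THE SAME IN FILE 1's TOKENS** (`ε = −1`): the right-hand side written as `μ(𝒪)³ · [(1 − q^{−σ})(1 − ε q^{−σ})(1 − ε q^{−(2σ−1)})] ∕ [(1 − q^{−(σ−1)})(1 − ε q^{−(σ−1)})(1 − ε q^{−(2σ−2)})]`.
[cite: MoeglinWaldspurger1995, IV.1.11] -/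
theorem integral_inertCell_pi_eq_localScalar {σ : ℝ} (hσ : 1 < σ) :
    ∫ p : Fin 3 → F, (max 1 (max ((max ((normAbs F (p 0) : ℝ≥0) : ℝ) ((normAbs F (p 1) : ℝ≥0) : ℝ)) ^ 2) ((normAbs F (p 2) : ℝ≥0) : ℝ))) ^ (-(2 * σ)) ∂(Measure.pi fun _ : Fin 3 => μ) =
      μ.real (primePowBall F 0) ^ 3 *
        ((1 - (residueFieldCard F : ℝ) ^ (-σ)) * (1 - (-1) * (residueFieldCard F : ℝ) ^ (-σ)) * (1 - (-1) * (residueFieldCard F : ℝ) ^ (-(2 * σ - 1))) /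
          ((1 - (residueFieldCard F : ℝ) ^ (-(σ - 1))) * (1 - (-1) * (residueFieldCard F : ℝ) ^ (-(σ - 1))) *
            (1 - (-1) * (residueFieldCard F : ℝ) ^ (-(2 * σ - 2))))) := by
  rw [integral_inertCell_pi_eq μ hσ, localScalar_shape_neg_one_eq (one_pos.trans (one_lt_residueFieldCard_real (F := F))) σ]

/-- **COMPLEX CURRENCY** (the local factors of ★ `AdelicProductIntegral` are `ℂ`-valued): `∫ ((W^{−2σ} : ℝ) : ℂ) d(μ⊗μ⊗μ) = ((μ(𝒪)³ · closed form : ℝ) : ℂ)` and the `ℂ`-valued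
integrand is integrable. [cite: TateThesis1967, §3.3] -/
theorem integral_inertCell_pi_ofReal_eq {σ : ℝ} (hσ : 1 < σ) :
    Integrable (fun p : Fin 3 → F => (((max 1 (max ((max ((normAbs F (p 0) : ℝ≥0) : ℝ) ((normAbs F (p 1) : ℝ≥0) : ℝ)) ^ 2) ((normAbs F (p 2) : ℝ≥0) : ℝ))) ^ (-(2 * σ)) : ℝ) : ℂ))
      (Measure.pi fun _ : Fin 3 => μ) ∧
    ∫ p : Fin 3 → F, (((max 1 (max ((max ((normAbs F (p 0) : ℝ≥0) : ℝ) ((normAbs F (p 1) : ℝ≥0) : ℝ)) ^ 2) ((normAbs F (p 2) : ℝ≥0) : ℝ))) ^ (-(2 * σ)) : ℝ) : ℂ) ∂(Measure.pi fun _ : Fin 3 => μ) =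
      ((μ.real (primePowBall F 0) ^ 3 *
        ((1 - (residueFieldCard F : ℝ) ^ (-(2 * σ))) * (1 + (residueFieldCard F : ℝ) ^ (-(2 * σ - 1))) /
          ((1 - (residueFieldCard F : ℝ) ^ (-(2 * σ - 2))) * (1 + (residueFieldCard F : ℝ) ^ (-(2 * σ - 2))))) : ℝ) : ℂ) := by
  refine ⟨(integrable_inertCell_pi μ hσ).ofReal, ?_⟩
  rw [integral_complex_ofReal, integral_inertCell_pi_eq μ hσ]

end Summit.HodgeConjecture.HodgeConjecture.Cruxes.H413.K2E1IntertwiningLocalMeanInertU3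

end
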